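import Summits.NavierStokesRegularity.NavierStokesRegularity.Theorems.ExtremiserTransienceTwoThirdsPackingSums
import Summits.NavierStokesRegularity.NavierStokesRegularity.Theorems.ExtremiserTransienceKStarAttainedPerturbation
import HarnessLib

/-!
# Route `ExtremiserTransience`, crux `NearExtremalTransiencePerFlow` (stmt-NavierStokesRegularity-26567),
# LINE g10-1 «two_thirds» (ns-idea-10), stub S1a′ — BRICK 2, lemma P4d: THE REMAINDER FIELD `w − Σ_c φ_c` OF A PACKING (structure)

`--supports stmt-NavierStokesRegularity-26567` (helper; prover seat ns-net-p2 g13).  For a `3ρ⁸`-separated finite family of centres `F` with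
cell pieces `φ c` and weights `χ c` (package `cell_piece`, p734300: everything of cell `c` lives in `B(c, 3ρ⁸/2)`), the REMAINDER FIELD
`φ_R = w + (−1)•Σ_c φ c` and REMAINDER WEIGHT `χ_R = 1 − Σ_c χ c` satisfy, pointwise,

* `remainder_weight` — `χ_R ∈ [0,1]`, `χ_R = 1` off `⋃ B(c, ρ⁸+ρ⁷)`, `χ_R = 0` on `⋃ B(c, ρ⁸)`;
* `remainder_sub_eq` — `φ_R − χ_R•w = −Σ_c (φ c − χ c • w)`, hence `‖φ_R‖ ≤ 1 + Cc/ρ²` (`remainder_norm_le`);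
* `remainder_fderiv_sub_eq` / `remainder_fderiv_sub_norm_le` — `Dφ_R − χ_R•Dw = −Σ_c (Dφ c − χ c • Dw)`, norm `≤ Cc/ρ²`;
* `remainder_curl_sub_eq`, `remainder_fderiv_curl_sub_eq` — the enstrophy / palinstrophy offsets of `φ_R` are minus the sums of the cells' offsets;
* `remainder_offsets_vanish` — they vanish off `⋃_c L_c ⊇ ((⋃ B(c,ρ⁸))ᶜ ∖ (⋃ B(c,ρ⁸+ρ⁷))ᶜ)`.
(One active cell per point: `…TwoThirdsPackingSums`, p734596.)  HONEST FRAMING: nothing about Navier–Stokes is proved; no summit is proved by a line. [folklore]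
-/

noncomputable section

open scoped Topology InnerProductSpace RealInnerProductSpace ENNReal NNReal ContDiff
open MeasureTheory Filter Set Metric
open Literature.Analysis.FluidPDE
open Summit.NavierStokesRegularity.NavierStokesRegularity.Theorems.DepletionLadder.KStar.HalfSpace
open Summit.NavierStokesRegularity.NavierStokesRegularity.Theorems.DepletionLadder

namespace Summit.NavierStokesRegularity.NavierStokesRegularity.Theorems.NearExtremalTransiencePerFlow.TwoThirds

-- the summit's namespace repeats the problem name by convention (D-0017)
set_option linter.dupNamespace false

section Remainder

variable {w : E3 → E3} {ρ Cc : ℝ} {F : Finset E3} {φ : E3 → E3 → E3} {χ : E3 → E3 → ℝ}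

/-- Cells of radius `ρ⁸ + ρ⁷ ≤ 3ρ⁸/2` (`ρ ≥ 2`). [folklore] -/
theorem rho_layer_le (hρ : 2 ≤ ρ) : ρ ^ 8 + ρ ^ 7 ≤ 3 / 2 * ρ ^ 8 := by
  have hρ0 : 0 < ρ := by linarith
  have : 2 * ρ ^ 7 ≤ ρ ^ 8 := by rw [show ρ ^ 8 = ρ * ρ ^ 7 by ring]; exact mul_le_mul_of_nonneg_right hρ (by positivity)
  linarith

/-- **The remainder weight** `χ_R = 1 − Σ χ c`: in `[0,1]`, `= 1` off `⋃ B(c, ρ⁸+ρ⁷)`, `= 0` on `⋃ B(c, ρ⁸)`. [folklore] -/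
theorem remainder_weight (hρ : 2 ≤ ρ) (hsep : ∀ c ∈ F, ∀ c' ∈ F, c ≠ c' → 2 * (3 / 2 * ρ ^ 8) ≤ dist c c')
    (hχ01 : ∀ c ∈ F, ∀ x, 0 ≤ χ c x ∧ χ c x ≤ 1) (hone : ∀ c ∈ F, ∀ x ∈ ball c (ρ ^ 8), χ c x = 1)
    (hout : ∀ c ∈ F, ∀ x, x ∉ ball c (ρ ^ 8 + ρ ^ 7) → χ c x = 0) :
    (∀ x, 0 ≤ 1 - ∑ c ∈ F, χ c x ∧ 1 - ∑ c ∈ F, χ c x ≤ 1) ∧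
    (∀ x ∈ (⋃ c ∈ F, ball c (ρ ^ 8 + ρ ^ 7))ᶜ, 1 - ∑ c ∈ F, χ c x = 1) ∧
    (∀ x, x ∉ (⋃ c ∈ F, ball c (ρ ^ 8))ᶜ → 1 - ∑ c ∈ F, χ c x = 0) := by
  have h32 := rho_layer_le hρ
  have hχ0 : ∀ c ∈ F, ∀ x, x ∉ ball c (3 / 2 * ρ ^ 8) → χ c x = 0 := fun c hc x hx =>
    hout c hc x fun h => hx (ball_subset_ball h32 h)
  refine ⟨fun x => ?_, fun x hx => ?_, fun x hx => ?_⟩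
  · have h := sum_mem_Icc_of_separated hsep hχ0 hχ01 x
    exact ⟨by linarith [h.2], by linarith [h.1]⟩
  · rw [Set.mem_compl_iff, Set.mem_iUnion₂] at hx
    push Not at hx
    rw [Finset.sum_eq_zero fun c hc => hout c hc x (hx c hc), sub_zero]
  · rw [Set.mem_compl_iff, not_not, Set.mem_iUnion₂] at hx
    obtain ⟨c₀, hc₀, hx₀⟩ := hx
    have hx₀' : x ∈ ball c₀ (3 / 2 * ρ ^ 8) := ball_subset_ball (by nlinarith [pow_pos (by linarith : (0:ℝ) < ρ) 8]) hx₀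
    rw [sum_eq_of_owner hsep hχ0 hc₀ hx₀', hone c₀ hc₀ x hx₀, sub_self]

/-- **`φ_R − χ_R•w = −Σ_c (φ c − χ c • w)`.** [folklore] -/
theorem remainder_sub_eq (x : E3) :
    (w x + (-1 : ℝ) • ∑ c ∈ F, φ c x) - (1 - ∑ c ∈ F, χ c x) • w x = -∑ c ∈ F, (φ c x - χ c x • w x) := by
  rw [Finset.sum_sub_distrib, sub_smul, one_smul, Finset.sum_smul]
  simp only [neg_smul, one_smul]
  abel

/-- **Height of the remainder**: `‖φ_R‖ ≤ 1 + Cc/ρ²`. [folklore] -/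
theorem remainder_norm_le (hρ : 2 ≤ ρ) (hCc : 0 ≤ Cc) (hsep : ∀ c ∈ F, ∀ c' ∈ F, c ≠ c' → 2 * (3 / 2 * ρ ^ 8) ≤ dist c c')
    (hw1 : ∀ x, ‖w x‖ ≤ 1) (hχ01 : ∀ c ∈ F, ∀ x, 0 ≤ χ c x ∧ χ c x ≤ 1)
    (hχsupp : ∀ c ∈ F, tsupport (χ c) ⊆ ball c (3 / 2 * ρ ^ 8))
    (hd : ∀ c ∈ F, ∀ x, ‖φ c x - χ c x • w x‖ ≤ Cc / ρ ^ 2) (hd0 : ∀ c ∈ F, ∀ x, x ∉ tsupport (χ c) → φ c x - χ c x • w x = 0) (x : E3) :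
    ‖w x + (-1 : ℝ) • ∑ c ∈ F, φ c x‖ ≤ 1 + Cc / ρ ^ 2 := by
  have hρ0 : 0 < ρ := by linarith
  have hχ0 : ∀ c ∈ F, ∀ x, x ∉ ball c (3 / 2 * ρ ^ 8) → χ c x = 0 := fun c hc x hx =>
    image_eq_zero_of_notMem_tsupport fun h => hx (hχsupp c hc h)
  have hg0 : ∀ c ∈ F, ∀ x, x ∉ ball c (3 / 2 * ρ ^ 8) → φ c x - χ c x • w x = 0 := fun c hc x hx =>
    hd0 c hc x fun h => hx (hχsupp c hc h)
  have heq : w x + (-1 : ℝ) • ∑ c ∈ F, φ c x = (1 - ∑ c ∈ F, χ c x) • w x + -∑ c ∈ F, (φ c x - χ c x • w x) := by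
    rw [← remainder_sub_eq x]; abel
  rw [heq]
  have hS := sum_mem_Icc_of_separated hsep hχ0 hχ01 x
  have h1 : ‖(1 - ∑ c ∈ F, χ c x) • w x‖ ≤ 1 := by
    rw [norm_smul, Real.norm_eq_abs, abs_of_nonneg (by linarith [hS.2])]
    calc (1 - ∑ c ∈ F, χ c x) * ‖w x‖ ≤ 1 * 1 := mul_le_mul (by linarith [hS.1]) (hw1 x) (norm_nonneg _) zero_le_one
      _ = 1 := one_mul 1
  have h2 : ‖-∑ c ∈ F, (φ c x - χ c x • w x)‖ ≤ Cc / ρ ^ 2 := by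
    rw [norm_neg]
    exact norm_sum_le_of_separated (g := fun c x => φ c x - χ c x • w x) hsep hg0 (by positivity) x fun c hc => hd c hc x
  exact (norm_add_le _ _).trans (add_le_add h1 h2)

/-- **`Dφ_R − χ_R•Dw = −Σ_c (Dφ c − χ c • Dw)`.** [folklore] -/
theorem remainder_fderiv_sub_eq (hw : ContDiff ℝ (⊤ : ℕ∞) w) (hφ : ∀ c ∈ F, ContDiff ℝ (⊤ : ℕ∞) (φ c)) (x : E3) :
    fderiv ℝ (fun y => w y + (-1 : ℝ) • ∑ c ∈ F, φ c y) x - (1 - ∑ c ∈ F, χ c x) • fderiv ℝ w x =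
      -∑ c ∈ F, (fderiv ℝ (φ c) x - χ c x • fderiv ℝ w x) := by
  have hwd : Differentiable ℝ w := hw.differentiable (by simp)
  have hΦd : Differentiable ℝ fun y => ∑ c ∈ F, φ c y := (contDiff_finset_sum hφ).differentiable (by simp)
  rw [KStar.fderiv_add_smul hwd hΦd (-1) x, fderiv_fun_sum fun c hc => ((hφ c hc).differentiable (by simp)) x,
    Finset.sum_sub_distrib, sub_smul (1 : ℝ) (∑ c ∈ F, χ c x) (fderiv ℝ w x), one_smul, Finset.sum_smul,
    neg_one_smul ℝ (∑ i ∈ F, fderiv ℝ (φ i) x)]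
  abel

/-- **Gradient offset of the remainder**: `‖Dφ_R − χ_R•Dw‖ ≤ Cc/ρ²`. [folklore] -/
theorem remainder_fderiv_sub_norm_le (hρ : 2 ≤ ρ) (hCc : 0 ≤ Cc) (hsep : ∀ c ∈ F, ∀ c' ∈ F, c ≠ c' → 2 * (3 / 2 * ρ ^ 8) ≤ dist c c')
    (hw : ContDiff ℝ (⊤ : ℕ∞) w) (hφ : ∀ c ∈ F, ContDiff ℝ (⊤ : ℕ∞) (φ c)) (hχsupp : ∀ c ∈ F, tsupport (χ c) ⊆ ball c (3 / 2 * ρ ^ 8))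
    (hd : ∀ c ∈ F, ∀ x, ‖fderiv ℝ (φ c) x - χ c x • fderiv ℝ w x‖ ≤ Cc / ρ ^ 2)
    (hd0 : ∀ c ∈ F, ∀ x, x ∉ tsupport (χ c) → fderiv ℝ (φ c) x - χ c x • fderiv ℝ w x = 0) (x : E3) :
    ‖fderiv ℝ (fun y => w y + (-1 : ℝ) • ∑ c ∈ F, φ c y) x - (1 - ∑ c ∈ F, χ c x) • fderiv ℝ w x‖ ≤ Cc / ρ ^ 2 := by
  have hρ0 : 0 < ρ := by linarith
  rw [remainder_fderiv_sub_eq hw hφ x, norm_neg]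
  have hg0 : ∀ c ∈ F, ∀ x, x ∉ ball c (3 / 2 * ρ ^ 8) → fderiv ℝ (φ c) x - χ c x • fderiv ℝ w x = 0 := fun c hc x hx =>
    hd0 c hc x fun h => hx (hχsupp c hc h)
  exact norm_sum_le_of_separated (g := fun c x => fderiv ℝ (φ c) x - χ c x • fderiv ℝ w x) hsep hg0 (by positivity) x fun c hc => hd c hc x

/-- **`curl φ_R` as a function.** [folklore] -/
theorem remainder_curl_eq (hw : ContDiff ℝ (⊤ : ℕ∞) w) (hφ : ∀ c ∈ F, ContDiff ℝ (⊤ : ℕ∞) (φ c)) :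
    curl (fun y => w y + (-1 : ℝ) • ∑ c ∈ F, φ c y) = fun x => curl w x + (-1 : ℝ) • ∑ c ∈ F, curl (φ c) x := by
  have hwd : Differentiable ℝ w := hw.differentiable (by simp)
  have hφd : ∀ c ∈ F, Differentiable ℝ (φ c) := fun c hc => (hφ c hc).differentiable (by simp)
  have hΦd : Differentiable ℝ fun y => ∑ c ∈ F, φ c y := (contDiff_finset_sum hφ).differentiable (by simp)
  funext x
  rw [curl_add (f := w) (g := fun y => (-1 : ℝ) • ∑ c ∈ F, φ c y) (hwd x) ((hΦd.const_smul (-1 : ℝ)) x),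
    curl_const_smul (f := fun y => ∑ c ∈ F, φ c y) (hΦd x), curl_finset_sum' fun c hc => hφd c hc x]

/-- **Enstrophy offset of the remainder**: `curl φ_R − χ_R•ω = −Σ_c (curl φ c − χ c • ω)`. [folklore] -/
theorem remainder_curl_sub_eq (hw : ContDiff ℝ (⊤ : ℕ∞) w) (hφ : ∀ c ∈ F, ContDiff ℝ (⊤ : ℕ∞) (φ c)) (x : E3) :
    curl (fun y => w y + (-1 : ℝ) • ∑ c ∈ F, φ c y) x - (1 - ∑ c ∈ F, χ c x) • curl w x =
      -∑ c ∈ F, (curl (φ c) x - χ c x • curl w x) := by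
  rw [remainder_curl_eq hw hφ, Finset.sum_sub_distrib, sub_smul, one_smul, Finset.sum_smul]
  simp only [neg_smul, one_smul]
  abel

/-- **Palinstrophy offset of the remainder**: `D(curl φ_R) − χ_R•Dω = −Σ_c (D(curl φ c) − χ c • Dω)`. [folklore] -/
theorem remainder_fderiv_curl_sub_eq (hw : ContDiff ℝ (⊤ : ℕ∞) w) (hφ : ∀ c ∈ F, ContDiff ℝ (⊤ : ℕ∞) (φ c)) (x : E3) :
    fderiv ℝ (curl fun y => w y + (-1 : ℝ) • ∑ c ∈ F, φ c y) x - (1 - ∑ c ∈ F, χ c x) • fderiv ℝ (curl w) x =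
      -∑ c ∈ F, (fderiv ℝ (curl (φ c)) x - χ c x • fderiv ℝ (curl w) x) := by
  have hω : ContDiff ℝ (⊤ : ℕ∞) (curl w) := contDiff_curl (n := ⊤) hw
  have hωc : ∀ c ∈ F, ContDiff ℝ (⊤ : ℕ∞) (curl (φ c)) := fun c hc => contDiff_curl (n := ⊤) (hφ c hc)
  rw [remainder_curl_eq hw hφ]
  have hwd : Differentiable ℝ (curl w) := hω.differentiable (by simp)
  have hΦd : Differentiable ℝ fun y => ∑ c ∈ F, curl (φ c) y := (contDiff_finset_sum hωc).differentiable (by simp)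
  rw [KStar.fderiv_add_smul hwd hΦd (-1) x, fderiv_fun_sum fun c hc => ((hωc c hc).differentiable (by simp)) x,
    Finset.sum_sub_distrib, sub_smul (1 : ℝ) (∑ c ∈ F, χ c x) (fderiv ℝ (curl w) x), one_smul, Finset.sum_smul,
    neg_one_smul ℝ (∑ i ∈ F, fderiv ℝ (curl (φ i)) x)]
  abel

/-- Off the union of the layers no cell layer is met: for `x ∉ (⋃B(c,ρ⁸))ᶜ ∖ (⋃B(c,ρ⁸+ρ⁷))ᶜ`, `x ∉ L_c` for every `c ∈ F`. [folklore] -/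
theorem notMem_layer_of_notMem (hρ : 2 ≤ ρ) (hsep : ∀ c ∈ F, ∀ c' ∈ F, c ≠ c' → 2 * (3 / 2 * ρ ^ 8) ≤ dist c c') {x : E3}
    (hx : x ∉ (⋃ c ∈ F, ball c (ρ ^ 8))ᶜ \ (⋃ c ∈ F, ball c (ρ ^ 8 + ρ ^ 7))ᶜ) {c : E3} (hc : c ∈ F) :
    x ∉ ball c (ρ ^ 8 + ρ ^ 7) \ ball c (ρ ^ 8) := by
  have hρ0 : 0 < ρ := by linarith
  have h32 := rho_layer_le hρ
  intro hxL
  apply hx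
  refine ⟨?_, ?_⟩
  · -- `x ∉ ⋃ B(c', ρ⁸)`
    rw [Set.mem_compl_iff, Set.mem_iUnion₂]
    rintro ⟨c', hc', hx'⟩
    by_cases hcc : c' = c
    · subst hcc; exact hxL.2 hx'
    · have hx32 : x ∈ ball c' (3 / 2 * ρ ^ 8) := ball_subset_ball (by nlinarith [pow_pos hρ0 8]) hx'
      exact packing_unique hsep hc' hx32 hc (Ne.symm hcc) (ball_subset_ball h32 hxL.1)
  · -- `x ∈ ⋃ B(c', ρ⁸+ρ⁷)`
    rw [Set.mem_compl_iff, not_not, Set.mem_iUnion₂]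
    exact ⟨c, hc, hxL.1⟩

end Remainder

end Summit.NavierStokesRegularity.NavierStokesRegularity.Theorems.NearExtremalTransiencePerFlow.TwoThirds

end
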